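import Mathlib.Data.List.GetD
import Mathlib.Tactic.IntervalCases
import Literature.Computability.FineGrained.LCSOVGadgets
import HarnessLib

/-!
# From Orthogonal Vectors to binary LCS: the strings of the reduction, bit by bit

Positional (random-access) description of the strings `ovX I`, `ovY I` of
`Literature.Computability.FineGrained.LCSOVGadgets` (Bringmann–Künnemann, FOCS 2015, §3.1 with
§4), in the form consumed by the word-RAM program of the reduction, which writes the two strings
one bit per loop iteration from closed-form position arithmetic instead of by nested loops:

* `BKLCS.Params.blockBit P ℓ z r`: bit `r` of a period `G(z) 0^{γ₃} = 1^{γ₂} 0^{γ₁} z 0^{γ₁} 1^{γ₂} 0^{γ₃}`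
  for a block `z` of length `ℓ` (six ranges), `BKLCS.Params.perOf P ℓ` its length, and
  **`getD_gadgetX`**: bit `p` of `G(z₀) 0^{γ₃} ⋯ G(z_{k-1})` (blocks of a common length `ℓ`) is
  `blockBit P ℓ z_{p / per} (p % per)`; `getD_gadgetY`: bit `p` of `0^N core 0^N`;
* the numerals of level `1` (`P₁ = (5,5,3)`: `γ₁ = 10, γ₂ = 60, γ₃ = 101, γ₄ = 130, per = 246`),
  and the coordinate words `1ₓ = 11100, 0ₓ = 10011, 1_y = 00111, 0_y = 11001` bit by bit as the
  word arithmetic of the program (`toNat_getD_coordX`, `toNat_getD_coordY`, `cgX_eq`, `cgS_eq`,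
  `cgY_eq`).
-/

namespace Literature.Computability.FineGrained

open Cryptography BKGadget
open scoped List

namespace BKLCS

/-! ### Bits of a period and of the gadget strings -/

/-- `getD` of a concatenation, as a case distinction on the index (cf. `List.getD_append`,
`List.getD_append_right`). [folklore] -/
theorem getD_append_eq_ite {α : Type*} (A B : List α) (d : α) (r : ℕ) :
    (A ++ B).getD r d = if r < A.length then A.getD r d else B.getD (r - A.length) d := by
  split_ifs with h
  · exact List.getD_append _ _ _ _ h
  · exact List.getD_append_right _ _ _ _ (Nat.not_lt.1 h)

/-- `getD` of a constant bit string. [folklore] -/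
theorem getD_replicate_bool (k : ℕ) (b : Bool) (r : ℕ) :
    (List.replicate k b).getD r false = if r < k then b else false := by
  split_ifs with h
  · rw [List.getD_eq_getElem _ _ (by simpa using h), List.getElem_replicate]
  · rw [List.getD_eq_default _ _ (by simpa using not_lt.1 h)]

namespace Params

variable (P : Params)

/-- Bit `r` of the period `G(z) 0^{γ₃} = 1^{γ₂} 0^{γ₁} z 0^{γ₁} 1^{γ₂} 0^{γ₃}` of a block `z` of length
`ℓ`: ones, zeros, `z`, zeros, ones, zeros. [folklore] -/
def blockBit (ℓ : ℕ) (z : List Bool) (r : ℕ) : Bool :=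
  if r < P.γ₂ then true
  else if r < P.γ₂ + P.γ₁ then false
  else if r < P.γ₂ + P.γ₁ + ℓ then z.getD (r - (P.γ₂ + P.γ₁)) false
  else if r < P.γ₂ + P.γ₁ + ℓ + P.γ₁ then false
  else if r < P.γ₂ + P.γ₁ + ℓ + P.γ₁ + P.γ₂ then true
  else false

/-- The period `|G(z) 0^{γ₃}| = 2γ₂ + 2γ₁ + ℓ + γ₃` of blocks of length `ℓ`. [folklore] -/
def perOf (ℓ : ℕ) : ℕ := 2 * P.γ₂ + 2 * P.γ₁ + ℓ + P.γ₃

/-- For blocks of length `ℓₓ` the period is `per`. [folklore] -/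
theorem perOf_ℓx : P.perOf P.ℓx = P.per := rfl

/-- **Bits of a period.** [folklore] -/
theorem getD_guard_append_zeros {ℓ : ℕ} {z : List Bool} (hz : z.length = ℓ) (r : ℕ) :
    (P.guard z ++ zeros P.γ₃).getD r false = P.blockBit ℓ z r := by
  unfold blockBit
  simp only [guard, List.append_assoc]
  rw [getD_append_eq_ite, length_ones]
  by_cases h1 : r < P.γ₂
  · rw [if_pos h1, if_pos h1, ones, getD_replicate_bool, if_pos h1]
  rw [if_neg h1, if_neg h1, getD_append_eq_ite, length_zeros]
  by_cases h2 : r < P.γ₂ + P.γ₁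
  · rw [if_pos (show r - P.γ₂ < P.γ₁ by omega), if_pos h2, zeros, getD_replicate_bool,
      if_pos (show r - P.γ₂ < P.γ₁ by omega)]
  rw [if_neg (show ¬ r - P.γ₂ < P.γ₁ by omega), if_neg h2, getD_append_eq_ite, hz]
  by_cases h3 : r < P.γ₂ + P.γ₁ + ℓ
  · rw [if_pos (show r - P.γ₂ - P.γ₁ < ℓ by omega), if_pos h3]
    congr 1; omega
  rw [if_neg (show ¬ r - P.γ₂ - P.γ₁ < ℓ by omega), if_neg h3, getD_append_eq_ite, length_zeros]
  by_cases h4 : r < P.γ₂ + P.γ₁ + ℓ + P.γ₁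
  · rw [if_pos (show r - P.γ₂ - P.γ₁ - ℓ < P.γ₁ by omega), if_pos h4, zeros, getD_replicate_bool,
      if_pos (show r - P.γ₂ - P.γ₁ - ℓ < P.γ₁ by omega)]
  rw [if_neg (show ¬ r - P.γ₂ - P.γ₁ - ℓ < P.γ₁ by omega), if_neg h4, getD_append_eq_ite, length_ones]
  by_cases h5 : r < P.γ₂ + P.γ₁ + ℓ + P.γ₁ + P.γ₂
  · rw [if_pos (show r - P.γ₂ - P.γ₁ - ℓ - P.γ₁ < P.γ₂ by omega), if_pos h5, ones,
      getD_replicate_bool, if_pos (show r - P.γ₂ - P.γ₁ - ℓ - P.γ₁ < P.γ₂ by omega)]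
  rw [if_neg (show ¬ r - P.γ₂ - P.γ₁ - ℓ - P.γ₁ < P.γ₂ by omega), if_neg h5, zeros,
    getD_replicate_bool]
  split_ifs <;> rfl

/-- Bits of a single guard are bits of its period. [folklore] -/
theorem getD_guard {ℓ : ℕ} {z : List Bool} (hz : z.length = ℓ) {r : ℕ} (hr : r < (P.guard z).length) :
    (P.guard z).getD r false = P.blockBit ℓ z r := by
  rw [← P.getD_guard_append_zeros hz r, getD_append_eq_ite, if_pos hr]

/-- **Bits of `G(z₀) 0^{γ₃} ⋯ 0^{γ₃} G(z_{k-1})`** for blocks of a common length `ℓ`: bit `p` is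
bit `p % per` of the period of block `p / per`. [folklore] -/
theorem getD_gadgetX {ℓ : ℕ} (hℓ : 0 < ℓ) :
    ∀ (zs : List (List Bool)), (∀ z ∈ zs, z.length = ℓ) → ∀ p, p < (P.gadgetX zs).length →
      (P.gadgetX zs).getD p false = P.blockBit ℓ (zs.getD (p / P.perOf ℓ) []) (p % P.perOf ℓ)
  | [], _, p, hp => by simp [gadgetX] at hp
  | [z], h, p, hp => by
      have hz : z.length = ℓ := h z (by simp)
      simp only [gadgetX] at hp ⊢
      have hlt : p < P.perOf ℓ := by
        rw [P.length_guard, hz] at hp; simp only [perOf]; omega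
      rw [Nat.div_eq_of_lt hlt, Nat.mod_eq_of_lt hlt]
      exact P.getD_guard hz hp
  | z :: z' :: zs, h, p, hp => by
      have hz : z.length = ℓ := h z (by simp)
      have h' : ∀ w ∈ z' :: zs, w.length = ℓ := fun w hw => h w (by simp [hw])
      have hper : (P.guard z ++ zeros P.γ₃).length = P.perOf ℓ := by
        simp [P.length_guard, hz, perOf]
      have hpos : 0 < P.perOf ℓ := by simp only [perOf]; omega
      rw [P.gadgetX_cons_cons] at hp ⊢
      rw [← List.append_assoc, getD_append_eq_ite, hper]
      split_ifs with hlt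
      · rw [Nat.div_eq_of_lt hlt, Nat.mod_eq_of_lt hlt, List.getD_cons_zero]
        exact P.getD_guard_append_zeros hz p
      · rw [not_lt] at hlt
        have hp' : p - P.perOf ℓ < (P.gadgetX (z' :: zs)).length := by
          rw [← List.append_assoc, List.length_append, hper] at hp; omega
        rw [getD_gadgetX hℓ (z' :: zs) h' (p - P.perOf ℓ) hp']
        have e1 : p / P.perOf ℓ = (p - P.perOf ℓ) / P.perOf ℓ + 1 := by
          rw [Nat.div_eq_sub_div hpos hlt]
        rw [e1, List.getD_cons_succ, Nat.mod_eq_sub_mod hlt]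

/-- **Bits of `y = 0^{N} core 0^{N}`** (`N = n' γ₄`, `core = gadgetX ys`). [folklore] -/
theorem getD_gadgetY (n' : ℕ) (ys : List (List Bool)) (p : ℕ) :
    (P.gadgetY n' ys).getD p false =
      if p < n' * P.γ₄ then false
      else if p - n' * P.γ₄ < (P.gadgetX ys).length then (P.gadgetX ys).getD (p - n' * P.γ₄) false
      else false := by
  simp only [gadgetY, zeros, getD_append_eq_ite, getD_replicate_bool, List.length_replicate]
  by_cases h1 : p < n' * P.γ₄
  · simp [h1]
  · simp only [h1, if_false]
    split_ifs with h2 <;> simp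

end Params

end BKLCS

/-! ### The numerals of level 1 -/

namespace BKLCSReduction

open BKLCS

/-- `γ₁ = 10` at level 1. [folklore] -/
theorem P₁_γ₁ : P₁.γ₁ = 10 := rfl
/-- `γ₂ = 60` at level 1. [folklore] -/
theorem P₁_γ₂ : P₁.γ₂ = 60 := rfl
/-- `γ₃ = 101` at level 1. [folklore] -/
theorem P₁_γ₃ : P₁.γ₃ = 101 := rfl
/-- `γ₄ = 130` at level 1. [folklore] -/
theorem P₁_γ₄ : P₁.γ₄ = 130 := rfl
/-- `ℓₓ = 5` at level 1. [folklore] -/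
theorem P₁_ℓx : P₁.ℓx = 5 := rfl
/-- The period `246` at level 1. [folklore] -/
theorem P₁_perOf : P₁.perOf 5 = 246 := rfl

/-! ### The coordinate words as word arithmetic -/

/-- `[b]` as a word. [folklore] -/
def ind (b : Prop) [Decidable b] : ℕ := if b then 1 else 0

/-- Bit `t < 5` of `1ₓ = 11100` / `0ₓ = 10011` selected by a word `s ∈ {0, 1}`:
`s · [t < 3] + [s = 0] · ([t = 0] + [2 < t])`. [cite: BringmannKunnemannFOCS2015, Lemma 4.1] -/
theorem toNat_getD_coordX (s : ℕ) (hs : s ≤ 1) {t : ℕ} (ht : t < 5) :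
    ((if s = 1 then oneX else zeroX).getD t false).toNat =
      s * ind (t < 3) + ind (s = 0) * (ind (t = 0) + ind (2 < t)) := by
  unfold ind
  interval_cases s <;> interval_cases t <;> rfl

/-- Bit `t < 5` of `1_y = 00111` / `0_y = 11001` selected by a word `s ∈ {0, 1}`:
`s · [1 < t] + [s = 0] · ([t < 2] + [t = 4])`. [cite: BringmannKunnemannFOCS2015, Lemma 4.1] -/
theorem toNat_getD_coordY (s : ℕ) (hs : s ≤ 1) {t : ℕ} (ht : t < 5) :
    ((if s = 1 then oneY else zeroY).getD t false).toNat =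
      s * ind (1 < t) + ind (s = 0) * (ind (t < 2) + ind (t = 4)) := by
  unfold ind
  interval_cases s <;> interval_cases t <;> rfl

variable {d : ℕ}

/-- `CG(a, k)` as a selected coordinate word: `1ₓ` iff `k < d` and `a[k] = 1`. [cite: BringmannKunnemannFOCS2015, §3.1 (coordinate gadgets)] -/
theorem cgX_eq (a : Fin d → Bool) (k : Fin (d + 1)) :
    cgX a k = if (ind ((k : ℕ) < d) * (if h : (k : ℕ) < d then (a ⟨k, h⟩).toNat else 0)) = 1
      then oneX else zeroX := by
  unfold cgX ind
  by_cases hk : (k : ℕ) < d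
  · simp only [hk, dite_true, if_true, Nat.one_mul]
    cases a ⟨k, hk⟩ <;> simp
  · simp [hk]

/-- `S`'s coordinates as a selected word: `1ₓ` iff `k = d`, i.e. `[k < d] = 0`. [cite: BringmannKunnemannFOCS2015, §3.1 (the string S)] -/
theorem cgS_eq (k : Fin (d + 1)) :
    cgS d k = if ind (¬ (k : ℕ) < d) = 1 then oneX else zeroX := by
  unfold cgS ind
  by_cases hk : (k : ℕ) < d <;> simp [hk]

/-- `CG(b, k)` as a selected word: `1_y` iff `k = d` or `b[k] = 1`. [cite: BringmannKunnemannFOCS2015, §3.1 (coordinate gadgets)] -/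
theorem cgY_eq (b : Fin d → Bool) (k : Fin (d + 1)) :
    cgY b k = if (ind ((k : ℕ) < d) * (if h : (k : ℕ) < d then (b ⟨k, h⟩).toNat else 0) +
      ind (¬ (k : ℕ) < d)) = 1 then oneY else zeroY := by
  unfold cgY ind
  by_cases hk : (k : ℕ) < d
  · simp only [hk, dite_true, if_true, Nat.one_mul, not_true, if_false, Nat.add_zero]
    cases b ⟨k, hk⟩ <;> simp
  · simp [hk]

end BKLCSReduction

end Literature.Computability.FineGrained
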